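import Summits.Ventures.Crystal3D.Theorems.StickyWulffConstantNoReconstructionGainAdhesionTCapDefs
import Summits.Ventures.Crystal3D.Theorems.StickyWulffConstantNoReconstructionGainLatticeAdhesion
import HarnessLib

/-!
# The capped T-form adhesion law IS a latticization law (crux `NoReconstructionGain` re-lined over Barlow hosts)

HONEST FRAMING. Part of the venture `Summits/Ventures/Crystal3D` (cell `crystal3d-full`), helper `--supports` the
crux `NoReconstructionGain` (stmt-Ventures-19144, route `route-Ventures-StickyWulffConstant`), lead wulff-p1 g19; the
kernel form of §1 of the gap memo `HOME/wulff-p1/g19/ADHESION-BARLOW-HOSTS.md` (cf-p1 DECISION (clx)).  PURE BOOKKEEPING: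
two uses of `contactDeficiency_sdiff_split`; nothing about packings is proved.

* `barlowAdhesionTCap_iff_latticize` — `BarlowAdhesionTCap` (σ arbitrary, lane T's re-typed stub) is EQUIVALENT to
  the LATTICIZATION LAW: for every admissible cell `X` over a Barlow host `S = stacking L s σ` there is a finite set
  `Y` of host sites with `X ∩ S ⊆ Y ⊆ S` and `D(Y) ≤ D(X) + C·(1+h)·ρ` — «replacing the off-host part of a cell by some
  set of vacant host sites never raises the deficiency by more than a rim term».  (`→`: `Y := (X ∩ S) ∪ Q`;
  `←`: `Q := Y ∖ (X ∩ S)`.)  This is the form in which the law has no reference energy `2φπρ²` (there is none for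
  σ ≠ const: the flat cut of a host with h-layers is not an optimal termination, memo §2(i)).
* `barlowAdhesionTCapFcc_iff_latticize` — the same for the fcc specialisation.

WHAT THIS IS NOT: no case of either law is proved here (the fcc case from the crux is
`…NoReconstructionGainAdhesionTForm`); rung F-C1 not moved.
-/

noncomputable section

open scoped BigOperators InnerProductSpace

namespace Summit.Ventures.Crystal3D.Cruxes.TextureLiminf.TexShadow

open Summit.Ventures.Crystal3D Summit.Ventures.Crystal3D.Theorems Finset
open Literature.MathematicalPhysics.StatisticalMechanics (IsHaggSeq constHagg contactDeficiency)

open scoped Classical in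
/-- The cell-wise equivalence behind both `iff`s: for a finite `X`, a set of sites `S`, `P := X ∩ S`, `B := X ∖ S`
and a real `E`, «some finite `Q ⊆ S` disjoint from `X` has `#cross(P,B) ≤ D(B) + (#cross(P,Q) − D(Q)) + E`» iff
«some finite `Y` with `P ⊆ Y ⊆ S` has `D(Y) ≤ D(X) + E`». -/
theorem exists_phantom_iff_exists_latticize (S : Set E3) (X : Finset E3) (E : ℝ) :
    (∃ Q : Finset E3, (↑Q : Set E3) ⊆ S ∧ Disjoint Q X ∧
      ((((X.filter fun p => p ∈ S) ×ˢ (X.filter fun p => p ∉ S)).filter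
          fun pq => dist pq.1 pq.2 = 1).card : ℝ) ≤
        contactDeficiency (X.filter fun p => p ∉ S) +
          ((((((X.filter fun p => p ∈ S) ×ˢ Q).filter fun pq => dist pq.1 pq.2 = 1).card : ℕ) : ℝ) -
            contactDeficiency Q) + E) ↔
    (∃ Y : Finset E3, (X.filter fun p => p ∈ S) ⊆ Y ∧ (↑Y : Set E3) ⊆ S ∧
      contactDeficiency Y ≤ contactDeficiency X + E) := by
  set P : Finset E3 := X.filter fun p => p ∈ S with hPdef
  have hPX : P ⊆ X := Finset.filter_subset _ _
  have hXP : X \ P = X.filter fun p => p ∉ S := by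
    ext z; simp only [hPdef, Finset.mem_sdiff, Finset.mem_filter]; tauto
  have hsplitX := contactDeficiency_sdiff_split hPX
  rw [hXP] at hsplitX
  constructor
  · rintro ⟨Q, hQS, hQX, hineq⟩
    have hPQ : Disjoint P Q := by
      rw [Finset.disjoint_left]; intro z hzP hzQ
      exact Finset.disjoint_left.1 hQX hzQ (hPX hzP)
    refine ⟨P ∪ Q, Finset.subset_union_left, ?_, ?_⟩
    · intro z hz
      rcases Finset.mem_union.1 (Finset.mem_coe.1 hz) with h | h
      · exact (Finset.mem_filter.1 h).2
      · exact hQS (Finset.mem_coe.2 h)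
    · have hsplitY := contactDeficiency_sdiff_split (Finset.subset_union_left : P ⊆ P ∪ Q)
      rw [Finset.union_sdiff_cancel_left hPQ] at hsplitY
      linarith
  · rintro ⟨Y, hPY, hYS, hineq⟩
    refine ⟨Y \ P, ?_, ?_, ?_⟩
    · intro z hz
      exact hYS (Finset.mem_coe.2 (Finset.mem_sdiff.1 (Finset.mem_coe.1 hz)).1)
    · rw [Finset.disjoint_left]
      intro z hzQ hzX
      obtain ⟨hzY, hzP⟩ := Finset.mem_sdiff.1 hzQ
      exact hzP (Finset.mem_filter.2 ⟨hzX, hYS (Finset.mem_coe.2 hzY)⟩)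
    · have hsplitY := contactDeficiency_sdiff_split hPY
      linarith

open scoped Classical in
/-- **`BarlowAdhesionTCap` ⟺ the latticization law** (σ arbitrary; see the module docstring). -/
theorem barlowAdhesionTCap_iff_latticize :
    BarlowAdhesionTCap ↔
    ∃ R C : ℝ, 1 ≤ R ∧ ∀ σ : ℤ → ℤ, IsHaggSeq σ → ∀ (L : E3 ≃ₗᵢ[ℝ] E3) (s ν : E3), ‖ν‖ = 1 →
      ∀ h : ℝ, 0 ≤ h → ∀ ρ : ℝ, R ≤ ρ → ∀ X : Finset E3,
      (∀ p ∈ X, ∀ q ∈ X, p ≠ q → 1 ≤ dist p q) →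
      (∀ p ∈ X, -(2 * R) ≤ ⟪p, ν⟫_ℝ ∧ ‖p‖ ^ 2 - ⟪p, ν⟫_ℝ ^ 2 ≤ ρ ^ 2) →
      (∀ p ∈ X, ⟪p, ν⟫_ℝ ≤ h) →
      (∀ p ∈ stacking L s σ, -(2 * R) ≤ ⟪p, ν⟫_ℝ → ⟪p, ν⟫_ℝ ≤ -R → ‖p‖ ^ 2 - ⟪p, ν⟫_ℝ ^ 2 ≤ ρ ^ 2 → p ∈ X) →
      ∃ Y : Finset E3, (X.filter fun p => p ∈ stacking L s σ) ⊆ Y ∧ (↑Y : Set E3) ⊆ stacking L s σ ∧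
        contactDeficiency Y ≤ contactDeficiency X + C * (1 + h) * ρ := by
  unfold BarlowAdhesionTCap
  constructor
  · rintro ⟨R, C, hR, hT⟩
    refine ⟨R, C, hR, fun σ hσ L s ν hν h hh ρ hρ X hX hcyl hcap hslab => ?_⟩
    exact (exists_phantom_iff_exists_latticize _ X _).1 (hT σ hσ L s ν hν h hh ρ hρ X hX hcyl hcap hslab)
  · rintro ⟨R, C, hR, hT⟩
    refine ⟨R, C, hR, fun σ hσ L s ν hν h hh ρ hρ X hX hcyl hcap hslab => ?_⟩
    exact (exists_phantom_iff_exists_latticize _ X _).2 (hT σ hσ L s ν hν h hh ρ hρ X hX hcyl hcap hslab)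

open scoped Classical in
/-- **`BarlowAdhesionTCapFcc` ⟺ the latticization law for fcc hosts.** -/
theorem barlowAdhesionTCapFcc_iff_latticize :
    BarlowAdhesionTCapFcc ↔
    ∃ R C : ℝ, 1 ≤ R ∧ ∀ (L : E3 ≃ₗᵢ[ℝ] E3) (s ν : E3), ‖ν‖ = 1 →
      ∀ h : ℝ, 0 ≤ h → ∀ ρ : ℝ, R ≤ ρ → ∀ X : Finset E3,
      (∀ p ∈ X, ∀ q ∈ X, p ≠ q → 1 ≤ dist p q) →
      (∀ p ∈ X, -(2 * R) ≤ ⟪p, ν⟫_ℝ ∧ ‖p‖ ^ 2 - ⟪p, ν⟫_ℝ ^ 2 ≤ ρ ^ 2) →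
      (∀ p ∈ X, ⟪p, ν⟫_ℝ ≤ h) →
      (∀ p ∈ stacking L s constHagg, -(2 * R) ≤ ⟪p, ν⟫_ℝ → ⟪p, ν⟫_ℝ ≤ -R →
        ‖p‖ ^ 2 - ⟪p, ν⟫_ℝ ^ 2 ≤ ρ ^ 2 → p ∈ X) →
      ∃ Y : Finset E3, (X.filter fun p => p ∈ stacking L s constHagg) ⊆ Y ∧
        (↑Y : Set E3) ⊆ stacking L s constHagg ∧
        contactDeficiency Y ≤ contactDeficiency X + C * (1 + h) * ρ := by
  unfold BarlowAdhesionTCapFcc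
  constructor
  · rintro ⟨R, C, hR, hT⟩
    refine ⟨R, C, hR, fun L s ν hν h hh ρ hρ X hX hcyl hcap hslab => ?_⟩
    exact (exists_phantom_iff_exists_latticize _ X _).1 (hT L s ν hν h hh ρ hρ X hX hcyl hcap hslab)
  · rintro ⟨R, C, hR, hT⟩
    refine ⟨R, C, hR, fun L s ν hν h hh ρ hρ X hX hcyl hcap hslab => ?_⟩
    exact (exists_phantom_iff_exists_latticize _ X _).2 (hT L s ν hν h hh ρ hρ X hX hcyl hcap hslab)

end Summit.Ventures.Crystal3D.Cruxes.TextureLiminf.TexShadow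

end
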